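import Mathlib
import Summits.Ventures.LatticeQCDFlow.Scaling.U1SlabMoments

/-!
# LatticeQCDFlow / Scaling — `U(1)` layer plaquette: the plaquette cosine `xObs`, its four bonds,
# `∫ xObs = 0` and `∫ xObs² = 1/2`

HONEST FRAMING: exact (Metropolis-corrected) sampling algorithms for lattice gauge theory;
figures of merit are autocorrelation/cost numbers at stated couplings and volumes; no
continuum-physics claim.

Venture `LatticeQCDFlow` (cell pub-lqcd), topic `Scaling`, FANOUT row 30 (lean-1) — OUR WORK (LEAD
LINE 230 (G3′)), lattice file 3 of the slab-chain proof of (LC) at every separation.  In a layer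
orthogonal to `a`, the plaquette `P = (0; i, j)` (`i, j ≠ a`, `i ≠ j`) has the four layer edges
`pedge` = `(0,i), (e_i,j), (e_j,i), (0,j)` with exponents `psgn = (1,1,−1,−1)`, the character
`plaqChar e = ∏_k e(pedge k)^{psgn k}` and the cosine `xObs e = Re (plaqChar e)` — the `U(1)`
plaquette observable read in layer coordinates.  `pedge_injective` (`L ≥ 2`), `plaqChar_mulSingle`
(rotating one bond multiplies the character by `z^{±1}`), and by rotating the first bond:
`integral_xObs` (`∫ xObs = 0`) and `integral_xObs_sq` (`∫ xObs² = 1/2`).  Elementary; nothing is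
cited as a fact; `def`s `zsite`, `usite`, `pedge`, `psgn`, `plaqChar`, `xObs`; no `sorry`.
-/

noncomputable section

open MeasureTheory Filter Finset
open Literature.MathematicalPhysics.QuantumFieldTheory

namespace Summit.Ventures.LatticeQCDFlow.Theory2.Lattice.U1Layer

variable {d L : ℕ} [NeZero L] {a i j : Fin d}

/-! ## 1. The plaquette of the layer and its cosine -/

/-- The origin of the layer. [folklore] -/
def zsite (d L : ℕ) (a : Fin d) : LSite d L a := ⟨0, rfl⟩

/-- The unit site `e_k` of the layer (`k ≠ a`). [folklore] -/
def usite {k : Fin d} (hk : k ≠ a) : LSite d L a := ⟨Pi.single k 1, by simp [hk.symm]⟩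

/-- The four layer edges of the plaquette `(0; i, j)`: `(0,i), (e_i,j), (e_j,i), (0,j)`. [folklore] -/
def pedge (hi : i ≠ a) (hj : j ≠ a) : Fin 4 → LEdge d L a
  | ⟨0, _⟩ => ⟨(zsite d L a, i), hi⟩
  | ⟨1, _⟩ => ⟨(usite hi, j), hj⟩
  | ⟨2, _⟩ => ⟨(usite hj, i), hi⟩
  | ⟨3, _⟩ => ⟨(zsite d L a, j), hj⟩

/-- The exponents `(1, 1, −1, −1)` of the four edges in the plaquette holonomy. [folklore] -/
def psgn : Fin 4 → ℤ
  | ⟨0, _⟩ => 1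
  | ⟨1, _⟩ => 1
  | ⟨2, _⟩ => -1
  | ⟨3, _⟩ => -1

/-- The plaquette character `e(ℓ₁) e(ℓ₂) e(ℓ₃)⁻¹ e(ℓ₄)⁻¹ = ∏_k e(pedge k)^{psgn k}`. [folklore] -/
def plaqChar (hi : i ≠ a) (hj : j ≠ a) (e : LEdge d L a → Circle) : Circle :=
  ∏ k : Fin 4, e (pedge hi hj k) ^ psgn k

/-- **The plaquette cosine** of the layer, `xObs e = Re (∏_k e(pedge k)^{psgn k})`. [folklore] -/
def xObs (hi : i ≠ a) (hj : j ≠ a) (e : LEdge d L a → Circle) : ℝ := ((plaqChar hi hj e : Circle) : ℂ).re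

section Plaquette

variable (hi : i ≠ a) (hj : j ≠ a) (hij : i ≠ j)
include hij

omit [NeZero L] in
/-- The four plaquette edges are pairwise distinct (`L ≥ 2`). [folklore] -/
theorem pedge_injective [NeZero L] (hL : 2 ≤ L) : Function.Injective (pedge (L := L) hi hj) := by
  have h10 : (usite (L := L) hi : LSite d L a) ≠ zsite d L a := by
    intro h
    have h' := congrArg (fun y : LSite d L a => (y.1 : Site d L) i) h
    simp only [usite, zsite, Pi.single_eq_same, Pi.zero_apply] at h'
    have h2 : (1 : ZMod L).val = 0 := by rw [h', ZMod.val_zero]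
    rw [ZMod.val_one_eq_one_mod, Nat.mod_eq_of_lt (by omega)] at h2
    exact one_ne_zero h2
  have h20 : (usite (L := L) hj : LSite d L a) ≠ zsite d L a := by
    intro h
    have h' := congrArg (fun y : LSite d L a => (y.1 : Site d L) j) h
    simp only [usite, zsite, Pi.single_eq_same, Pi.zero_apply] at h'
    have h2 : (1 : ZMod L).val = 0 := by rw [h', ZMod.val_zero]
    rw [ZMod.val_one_eq_one_mod, Nat.mod_eq_of_lt (by omega)] at h2
    exact one_ne_zero h2
  intro k l hkl
  have h1 : ((pedge hi hj k).1 : LSite d L a × Fin d) = (pedge hi hj l).1 := congrArg Subtype.val hkl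
  fin_cases k <;> fin_cases l <;> simp only [pedge, Prod.mk.injEq] at h1 ⊢ <;>
    first
    | rfl
    | (exfalso
       rcases h1 with ⟨h1a, h1b⟩
       first
       | exact h10 h1a
       | exact h10 h1a.symm
       | exact h20 h1a
       | exact h20 h1a.symm
       | exact hij h1b
       | exact hij h1b.symm)

omit [NeZero L] hij in
/-- `|xObs| ≤ 1`. [folklore] -/
theorem abs_xObs_le (e : LEdge d L a → Circle) : |xObs hi hj e| ≤ 1 :=
  (Complex.abs_re_le_norm _).trans (le_of_eq (Circle.norm_coe _))

omit [NeZero L] hij in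
/-- The plaquette character is continuous. [folklore] -/
theorem continuous_plaqChar : Continuous fun e : LEdge d L a → Circle => (plaqChar hi hj e : Circle) := by
  have h1 : ∀ k, Continuous fun e : LEdge d L a → Circle => (e (pedge hi hj k) ^ psgn k : Circle) :=
    fun k => by fun_prop
  unfold plaqChar
  exact continuous_finsetProd _ fun k _ => h1 k

omit [NeZero L] hij in
/-- `xObs` is continuous. [folklore] -/
theorem continuous_xObs : Continuous (xObs (L := L) hi hj) :=
  Complex.continuous_re.comp (continuous_subtype_val.comp (continuous_plaqChar hi hj))

omit [NeZero L] hij in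
/-- **Rotating one plaquette bond** multiplies the plaquette character by the rotation to the
power `psgn k`. [folklore] -/
theorem plaqChar_mulSingle (hinj : Function.Injective (pedge (L := L) hi hj)) (k : Fin 4) (z : Circle)
    (e : LEdge d L a → Circle) :
    plaqChar hi hj (Pi.mulSingle (pedge hi hj k) z * e) = z ^ psgn k * plaqChar hi hj e := by
  unfold plaqChar
  rw [← Finset.mul_prod_erase univ _ (mem_univ k), ← Finset.mul_prod_erase univ (fun k => e _ ^ _)
    (mem_univ k)]
  simp only [Pi.mul_apply, Pi.mulSingle_eq_same, mul_zpow, mul_assoc]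
  congr 1
  congr 1
  refine prod_congr rfl fun l hl => ?_
  rw [Pi.mulSingle_eq_of_ne (fun h => (ne_of_mem_erase hl) (hinj h)), one_zpow, one_mul]

/-- **`∫ xObs = 0`** (rotate the first bond by `−1`). [folklore] -/
theorem integral_xObs (hL : 2 ≤ L) :
    ∫ e, (xObs hi hj e : ℂ) ∂(Measure.pi fun _ : LEdge d L a => haarProbability Circle) = 0 := by
  set z₀ : Circle := Circle.exp Real.pi with hz₀
  have hz : (z₀ : ℂ) = -1 := by rw [hz₀, Circle.coe_exp, Complex.exp_pi_mul_I]
  have hinj := pedge_injective hi hj hij hL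
  have h := integral_mul_left_eq_self (μ := Measure.pi fun _ : LEdge d L a => haarProbability Circle)
    (fun e => (xObs hi hj e : ℂ)) (Pi.mulSingle (pedge hi hj 0) z₀)
  have hneg : ∀ e : LEdge d L a → Circle,
      (xObs hi hj (Pi.mulSingle (pedge hi hj 0) z₀ * e) : ℂ) = -(xObs hi hj e : ℂ) := by
    intro e
    rw [xObs, xObs, plaqChar_mulSingle hi hj hinj, Circle.coe_mul, Circle.coe_zpow, hz]
    simp [psgn]
  simp_rw [hneg, integral_neg] at h
  have h2 : (2 : ℂ) * ∫ e, (xObs hi hj e : ℂ)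
      ∂(Measure.pi fun _ : LEdge d L a => haarProbability Circle) = 0 := by linear_combination -h
  exact (mul_eq_zero.1 h2).resolve_left two_ne_zero

/-- **`∫ xObs² = 1/2`** (`(Re P)² = (P² + P⁻² + 2)/4` and `∫ P^{±2} = 0` by rotating the first bond
by `i`). [folklore] -/
theorem integral_xObs_sq (hL : 2 ≤ L) :
    ∫ e, (xObs hi hj e : ℂ) ^ 2 ∂(Measure.pi fun _ : LEdge d L a => haarProbability Circle) = 1 / 2 := by
  set μE := Measure.pi fun _ : LEdge d L a => haarProbability Circle with hμE
  have hinj := pedge_injective hi hj hij hL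
  -- `∫ P² = 0`
  set z₀ : Circle := Circle.exp (Real.pi / 2) with hz₀
  have hz2 : ((z₀ : ℂ)) ^ 2 = -1 := by
    rw [hz₀, Circle.coe_exp, ← Complex.exp_nat_mul]
    have h2 : ((2 : ℕ) : ℂ) * (((Real.pi / 2 : ℝ) : ℂ) * Complex.I) = Real.pi * Complex.I := by
      push_cast; ring
    rw [h2, Complex.exp_pi_mul_I]
  have hP2 : ∀ s : ℤ, s = 2 ∨ s = -2 →
      ∫ e, ((plaqChar hi hj e : Circle) : ℂ) ^ s ∂μE = 0 := by
    intro s hs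
    have h := integral_mul_left_eq_self (μ := μE) (fun e => ((plaqChar hi hj e : Circle) : ℂ) ^ s)
      (Pi.mulSingle (pedge hi hj 0) z₀)
    have hrot : ∀ e : LEdge d L a → Circle,
        ((plaqChar hi hj (Pi.mulSingle (pedge hi hj 0) z₀ * e) : Circle) : ℂ) ^ s =
        -(((plaqChar hi hj e : Circle) : ℂ) ^ s) := by
      intro e
      rw [plaqChar_mulSingle hi hj hinj, Circle.coe_mul, mul_zpow, Circle.coe_zpow]
      have hz2' : (z₀ : ℂ) ^ (2 : ℤ) = -1 := by rw [zpow_ofNat]; exact hz2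
      have : ((z₀ : ℂ) ^ psgn 0) ^ s = -1 := by
        have h0 : psgn 0 = 1 := rfl
        rcases hs with rfl | rfl
        · rw [h0, zpow_one, hz2']
        · rw [h0, zpow_one, zpow_neg, hz2']; norm_num
      rw [this]; ring
    simp_rw [hrot, integral_neg] at h
    have h2 : (2 : ℂ) * ∫ e, ((plaqChar hi hj e : Circle) : ℂ) ^ s ∂μE = 0 := by linear_combination -h
    exact (mul_eq_zero.1 h2).resolve_left two_ne_zero
  -- `(Re P)² = (P² + P⁻² + 2)/4`
  have hsq : ∀ e : LEdge d L a → Circle, (xObs hi hj e : ℂ) ^ 2 =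
      4⁻¹ * (((plaqChar hi hj e : Circle) : ℂ) ^ (2 : ℤ) + ((plaqChar hi hj e : Circle) : ℂ) ^ (-2 : ℤ)) +
        2⁻¹ := by
    intro e
    have hre := re_coe_eq_half_sum (plaqChar hi hj e)
    rw [Fintype.sum_bool] at hre
    simp only [sgn, if_true, Bool.false_eq_true, if_false, zpow_one, Circle.coe_zpow] at hre
    rw [xObs, hre]
    have hne : ((plaqChar hi hj e : Circle) : ℂ) ≠ 0 := Circle.coe_ne_zero _
    field_simp
    ring
  simp_rw [hsq]
  have hPc : Continuous fun e : LEdge d L a → Circle => ((plaqChar hi hj e : Circle) : ℂ) :=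
    continuous_subtype_val.comp (continuous_plaqChar hi hj)
  have hi1 : Integrable (fun e => ((plaqChar hi hj e : Circle) : ℂ) ^ (2 : ℤ)) μE :=
    Integrable.of_bound ((hPc.zpow₀ 2 fun e => Or.inl (Circle.coe_ne_zero _)).measurable
      |>.aestronglyMeasurable) 1 (Eventually.of_forall fun e => by simp)
  have hi2 : Integrable (fun e => ((plaqChar hi hj e : Circle) : ℂ) ^ (-2 : ℤ)) μE :=
    Integrable.of_bound ((hPc.zpow₀ (-2) fun e => Or.inl (Circle.coe_ne_zero _)).measurable
      |>.aestronglyMeasurable) 1 (Eventually.of_forall fun e => by simp)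
  have hi12 : Integrable (fun e => (4⁻¹ : ℂ) * (((plaqChar hi hj e : Circle) : ℂ) ^ (2 : ℤ) +
      ((plaqChar hi hj e : Circle) : ℂ) ^ (-2 : ℤ))) μE := (hi1.add hi2).const_mul (4⁻¹ : ℂ)
  rw [integral_add hi12 (integrable_const _), integral_const_mul, integral_add hi1 hi2,
    hP2 2 (Or.inl rfl), hP2 (-2) (Or.inr rfl), integral_const, probReal_univ]
  simp

end Plaquette

end Summit.Ventures.LatticeQCDFlow.Theory2.Lattice.U1Layer

end
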